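import Literature.NumberTheory.Kottwitz1992.KottwitzTriples
import HarnessLib

/-!
# Kottwitz (1992) §15: the vanishing of `α(γ₀; γ, δ)` — Lemma 15.1, its generalization Lemma 15.2 (`α(γ₀; A, λ, i)` is trivial),
# and the three printed steps by which 15.2 implies 15.1 — as a LETTER over the §14 datum `KottwitzTriples.KottwitzTripleData`
(R. E. Kottwitz, *Points on some Shimura varieties over finite fields*, J. Amer. Math. Soc. 5 (1992) 373–444, §15 pp. 423–429)

Topic `NumberTheory/Kottwitz1992`; namespace `Literature.NumberTheory.Kottwitz1992.AlphaVanishing`.  STATEMENTS ONLY over the landed datum ★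
`Literature.NumberTheory.Kottwitz1992.KottwitzTriples.KottwitzTripleData` (its fields `alpha`, `kdOne`, `alphaObj`, `xzOne`, `inflate`, `IsInnerTwist`,
`LadicMatch` and relations `Assumptions`, `WeakHyp` are the §15 vocabulary, posited there with their page pins): one `def … (D : KottwitzTripleData) : Prop`
per printed statement, verbatim numbering.  No theorem, no proof, no `sorry`, no `axiom`, no instance, no notation, no new datum.  Cell hodgecm-mathlib,
carpet squad TK (seat TK-t06).  HC_CM is proved only modulo the printed citations until rung 0 closes; nothing here is about HC.

## Source (held text `paper:doi-10-2307-2152772`, file `p00NN` = printed page `372 + NN`; §15 = p0051–p0057 = pp. 423–429)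

[p. 423] «We keep the notation of §14 and continue to exclude Case D. Starting from a `c`-polarized virtual `B`-abelian variety `(A, λ, i)` over `k_r`
up to isogeny satisfying the three assumptions of §14, we constructed a triple `(γ₀; γ, δ)` satisfying the conditions of §2 of [K5]. In that section of
that paper there is a construction of an element `α(γ₀; γ, δ) ∈ 𝔎(I₀/ℚ)^D`, where `I₀` denotes the centralizer of `γ₀` in `G`. The group `I₀` is
connected and reductive since `γ₀` is semisimple and the derived group of `G` is simply connected. Recall that `𝔎(I₀/ℚ)` is the subgroup of
`π₀((Z(Î₀)/Z(Ĝ))^Γ)` consisting of elements whose image in `H¹(ℚ, Z(Ĝ))` lies in `ker¹(ℚ, Z(Ĝ))` … In this section we will prove the following result.»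
**LEMMA 15.1** (p. 423): «Let `(A, λ, i)` be a `c`-polarized virtual `B`-abelian variety over `k_r` satisfying the three conditions of §14, and let
`(γ₀; γ, δ)` be the triple associated to `(A, λ, i)`. Then the element `α(γ₀; γ, δ)` of `𝔎(I₀/ℚ)^D` is trivial.»  (pp. 423–424) «we will need a slight
generalization of Lemma 15.1 … we do not assume that `(A, λ, i)` satisfies the three conditions of §14. Instead we make the following weaker assumption.
We assume that there exists a semisimple element `γ₀ ∈ G(ℚ)`, elliptic in `G(ℝ)`, with `γ₀γ₀* = c⁻¹`, and such that for every prime `l` different from `p`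
the `B ⊗_ℚ ℚ_l[T]`-modules `V_l := V ⊗_ℚ ℚ_l` and `H_l := H₁(A, ℚ_l)` are isomorphic, where `T` acts on `V_l` by `γ₀⁻¹` and on `H_l` by `π_A`. Put
`I := Aut(A, λ, i)` and `I₀ := G_{γ₀}`. We claim that `I` is an inner twist of `I₀` (canonically, up to inner automorphisms of `I₀` over `ℚ̄`).»  (p. 424)
«We are going to generalize the construction of `α(γ₀; γ, δ)` by constructing an element `α(γ₀; A, λ, i) ∈ X^*(Z(Î₀)^Γ)`. As usual we first define, for
each place `v` of `ℚ`, an element `α_v ∈ X^*(Z(Î₀)^{Γ(v)})`, and then we define `α(γ₀; A, λ, i)` to be the product over all places of `ℚ` of the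
restrictions of `α_v` to `Z(Î₀)^Γ`» (`α_l` from `H¹(ℚ_l, I₀) → π₀(Z(Î₀)^{Γ(l)})^D`, `α_p` from `B((I₀)_{ℚ_p}) → X^*(Z(Î₀)^{Γ(p)})`, `α_∞` from `μ_{h₁}`).
**LEMMA 15.2** (p. 425): «The element `α(γ₀; A, λ, i)` is trivial.»  (p. 425) «Before proving Lemma 15.2 let us check that Lemma 15.2 implies Lemma
15.1. The first point to verify is that the natural map `Z(Î₀)^Γ → 𝔎(I₀/ℚ)` is surjective in the situation at hand. … from the discussion in §7 we know
that the canonical map `ker¹(ℚ, Z) → ker¹(ℚ, G)` is surjective (even bijective) in both Case A and Case C … Now suppose that `(A, λ, i)`, `(γ₀; γ, δ)`,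
and `α(γ₀; γ, δ)` are as in Lemma 15.1. We use the surjection `Z(Î₀)^Γ → 𝔎(I₀/ℚ)` to view `α(γ₀; γ, δ)` as an element of `X^*(Z(Î₀)^Γ)`. We also have
the element `α(γ₀; A, λ, i) ∈ X^*(Z(Î₀)^Γ)`, which Lemma 15.2 states is trivial. Since a glance at the definition of the local factors of `α(γ₀; γ, δ)`
and `α(γ₀; A, λ, i)` shows that they are the same, we see that `α(γ₀; γ, δ)` is trivial, as desired.»  (pp. 425–429: proof of Lemma 15.2 — a maximal torus
`T ⊂ I` elliptic at `∞` transfers to `I₀`, `N = Cent_M(T)` is a CM-algebra, a character `α′` on `T̂^Γ` restricting to `α(γ₀; A, λ, i)` is built as in §13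
and shown trivial by Lemma 13.2, via Morita equivalence `B ⊗_F N ≅ M_d(N)` when `B ≠ F` — NOT typed.)

## What is typed (all `Prop`-valued, over `D : KottwitzTripleData`)

`WeakHypOfTriple` (the §14 triple satisfies the weaker assumption, p. 423), `InnerTwist15` (p. 424), **`Kottwitz1992_15_1_alphaTrivial`** (Lemma 15.1),
**`Kottwitz1992_15_2_alphaObjTrivial`** (Lemma 15.2), `InflateInjective` (the surjectivity `Z(Î₀)^Γ ↠ 𝔎(I₀/ℚ)` of p. 425, recorded on the dual side the
datum posits), `InflateOne`, `AlphaCompat` («the local factors … are the same», p. 425), and the conjunction `PrintedLaws15`.  The book-keeping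
implication «15.2 ∧ surjectivity ∧ same local factors ⇒ 15.1» is NOT asserted here (statements only); a consumer derives it from `InflateInjective`,
`InflateOne`, `AlphaCompat`, `Kottwitz1992_15_2_alphaObjTrivial` and `WeakHypOfTriple` in three lines.

References: [Kottwitz1992] R. E. Kottwitz, JAMS 5 (1992), §15 pp. 423–429 (Lemma 15.1 p. 423, Lemma 15.2 p. 425); [K5] of the source = R. E. Kottwitz,
*Shimura varieties and λ-adic representations* (1990), §2 — cited by the source for `α(γ₀; γ, δ)`, not restated.
-/

namespace Literature.NumberTheory.Kottwitz1992.AlphaVanishing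

open Literature.NumberTheory.Kottwitz1992.KottwitzTriples

universe u

variable (D : KottwitzTripleData.{u})

/-- **«Instead we make the following weaker assumption»**: for `(A, λ, i)` under the three assumptions of §14 and the `γ₀` of its triple (any maximal
torus `T ⊂ I`, any `*`-embedding), the pair `((A, λ, i), γ₀)` satisfies the weaker assumption of §15 (`γ₀` semisimple, elliptic in `G(ℝ)`, `γ₀γ₀* = c⁻¹`,
`V_l ≅ H_l` as `B ⊗_ℚ ℚ_l[T]`-modules for all `l ≠ p`) — the sense in which Lemma 15.2 is «a slight generalization of Lemma 15.1», AS A RELATION.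
[cite: Kottwitz1992, §15 (pp. 423–424)] -/
def WeakHypOfTriple : Prop :=
  ∀ X : D.Obj, D.Assumptions X → ∀ (T : D.MaxTorus X) (e : D.Emb X T), D.IsStarHom e → D.WeakHyp X (D.gamma0Of X T e)

/-- **«Put `I := Aut(A, λ, i)` and `I₀ := G_{γ₀}`. We claim that `I` is an inner twist of `I₀` (canonically, up to inner automorphisms of `I₀` over
`ℚ̄`)»** — under the weaker assumption of §15, AS A RELATION. [cite: Kottwitz1992, §15 (pp. 423–424)] -/
def InnerTwist15 : Prop :=
  ∀ (X : D.Obj) (γ₀ : D.GQ), D.WeakHyp X γ₀ → D.IsInnerTwist X γ₀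

/-- **LEMMA 15.1**: «Let `(A, λ, i)` be a `c`-polarized virtual `B`-abelian variety over `k_r` satisfying the three conditions of §14, and let
`(γ₀; γ, δ)` be the triple associated to `(A, λ, i)`. Then the element `α(γ₀; γ, δ)` of `𝔎(I₀/ℚ)^D` is trivial.» — AS A RELATION over the datum, for
every choice (maximal torus `T ⊂ I`, `*`-embedding `N → C`, the two isomorphisms) producing the triple. [cite: Kottwitz1992, Lemma 15.1 (p. 423)] -/
def Kottwitz1992_15_1_alphaTrivial : Prop :=
  ∀ X : D.Obj, D.Assumptions X → ∀ (T : D.MaxTorus X) (e : D.Emb X T), D.IsStarHom e →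
    ∀ (e₁ : D.Iso1 X) (e₂ : D.Iso2 X),
      D.alpha (D.gamma0Of X T e) (D.gammaOf X e₁) (D.deltaOf X e₂) = D.kdOne (D.gamma0Of X T e)

/-- **LEMMA 15.2**: «The element `α(γ₀; A, λ, i)` is trivial.» — for a `c`-polarized virtual `B`-abelian variety `(A, λ, i)` over `k_r` up to isogeny
and `γ₀ ∈ G(ℚ)` under the weaker assumption of §15, `α(γ₀; A, λ, i) ∈ X^*(Z(Î₀)^Γ)` the product of the local characters of p. 424, AS A RELATION.
[cite: Kottwitz1992, Lemma 15.2 (p. 425)] -/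
def Kottwitz1992_15_2_alphaObjTrivial : Prop :=
  ∀ (X : D.Obj) (γ₀ : D.GQ), D.WeakHyp X γ₀ → D.alphaObj γ₀ X = D.xzOne γ₀

/-- **«The first point to verify is that the natural map `Z(Î₀)^Γ → 𝔎(I₀/ℚ)` is surjective in the situation at hand»** (shown on p. 425 in Cases A
and C from `ker¹(ℚ, Z) ≅ ker¹(ℚ, G)` of §7, Lemma 4.3.1 of [K2] and Tate–Nakayama duality) — recorded over this datum, which posits only the character
groups `𝔎(I₀/ℚ)^D` and `X^*(Z(Î₀)^Γ)`, as the injectivity of the dual map `inflate`, AS A RELATION (for the `γ₀` of a §14 triple).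
[cite: Kottwitz1992, §15 (p. 425)] -/
def InflateInjective : Prop :=
  ∀ X : D.Obj, D.Assumptions X → ∀ (T : D.MaxTorus X) (e : D.Emb X T), D.IsStarHom e →
    Function.Injective (D.inflate (D.gamma0Of X T e))

/-- The dual map `𝔎(I₀/ℚ)^D → X^*(Z(Î₀)^Γ)` takes the trivial character to the trivial character (used tacitly on p. 425: «we see that
`α(γ₀; γ, δ)` is trivial»), AS A RELATION. [cite: Kottwitz1992, §15 (p. 425)] -/
def InflateOne : Prop :=
  ∀ γ₀ : D.GQ, D.inflate γ₀ (D.kdOne γ₀) = D.xzOne γ₀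

/-- **«Since a glance at the definition of the local factors of `α(γ₀; γ, δ)` and `α(γ₀; A, λ, i)` shows that they are the same»**: viewed in
`X^*(Z(Î₀)^Γ)` through the surjection `Z(Î₀)^Γ → 𝔎(I₀/ℚ)`, `α(γ₀; γ, δ)` of the §14 triple IS `α(γ₀; A, λ, i)`, AS A RELATION.
[cite: Kottwitz1992, §15 (p. 425)] -/
def AlphaCompat : Prop :=
  ∀ X : D.Obj, D.Assumptions X → ∀ (T : D.MaxTorus X) (e : D.Emb X T), D.IsStarHom e →
    ∀ (e₁ : D.Iso1 X) (e₂ : D.Iso2 X),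
      D.inflate (D.gamma0Of X T e) (D.alpha (D.gamma0Of X T e) (D.gammaOf X e₁) (D.deltaOf X e₂)) =
        D.alphaObj (D.gamma0Of X T e) X

/-- The conjunction of the §15 relations: Lemma 15.2, the inner-twist claim, the weaker assumption for §14 triples, the three book-keeping relations
of p. 425, and Lemma 15.1 itself (what a consumer of §§16–19 takes as ONE hypothesis). [cite: Kottwitz1992, §15 (pp. 423–425)] -/
def PrintedLaws15 : Prop :=
  WeakHypOfTriple D ∧ InnerTwist15 D ∧ Kottwitz1992_15_2_alphaObjTrivial D ∧ InflateInjective D ∧ InflateOne D ∧ AlphaCompat D ∧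
    Kottwitz1992_15_1_alphaTrivial D

end Literature.NumberTheory.Kottwitz1992.AlphaVanishing
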